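import Summits.QuantumAdvantage.QuantumAdvantage.Theorems.OneQuadDriverA

set_option linter.dupNamespace false
set_option linter.unusedSectionVars false

/-!
# OneQuadAsymptoticA (lens 4, g29; (c0) = `OneQuadNoPerfectOdd` modulo Bogolyubov–Ruzsa: the asymptotic parameter instantiation)

Blocker `X = AbsorptionDial.NoPerfectPolyOdd` (item 28487); decomp-qadv lens 4, g29.

`OneQuadDriverA.loss_of_oneQuad_param` decides the (c0) normal form under an explicit list of numeric side conditions.  Here the ten parameters
are instantiated as explicit polylogarithmic functions of `n` (with `k ≤ (log₂ n)^Cexp`), every side condition but one is verified identically, and the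
remaining one (`polylog(n) ≤ n`) holds for `n ≥ n₀` (`polylog_eventually_le`, from `tendsto_pow_const_div_const_pow_of_one_lt`).
* `polylog_eventually_le A B : ∃ n₀, ∀ n ≥ n₀, A·(log₂ n + 1)^B ≤ n`;
* power bookkeeping done by LOCAL helpers inside `loss_of_oneQuad` (the folklore `a ≤ X^i → b ≤ X^j → ab ≤ X^(i+j)` family is already in
  `Literature.Computability.MetaComplexity.DepthFregeHalving` as `xb_mul/xb_add`; not restated here);
* ★ `loss_of_oneQuad` — for `p ≥ 5` and a Bogolyubov–Ruzsa constant `C` for `𝔽_p`: `∃ n₀, ∀ n ≥ n₀, ∀ k ≤ (log₂ n)^Cexp`, every OneQuad register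
  normal form (registers `g ≠ g₀` `k`-forms, `g₀ = H(labels, quadVal M b)`) loses some ring word;
* ★ `oneQuadNoPerfectOdd_of_BR` — the sub-rung `OneQuadNoPerfectOdd` of NODE-g28 (restated verbatim as `OneQuad` / `OneQuadNoPerfectOdd`) follows from the
  finite-field Bogolyubov–Ruzsa lemma with Sanders' bound (hypothesis `hBR`, the typed Literature fact `bogolyubovRuzsaFiniteField`).
Supports stmt-QuantumAdvantage-28487 (record; the residual `X` is NOT claimed — `X ⟺ QuadFormNoPerfectOdd ∧ QuadLiftOdd`, and (c0) is the one-quadratic-register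
sub-rung of `QuadFormNoPerfectOdd`).
-/

open Finset Module Filter
open Summit.QuantumAdvantage.AdviceFreeQNC0
open Summit.QuantumAdvantage.QuantumAdvantage.Theorems.InnerDegreeDial

namespace Summit.QuantumAdvantage.QuantumAdvantage.Theorems.ColumnBridge

section Growth

/-- **polylog is eventually below linear**: `A·(log₂ n + 1)^B ≤ n` for `n ≥ n₀(A, B)`. -/
theorem polylog_eventually_le (A B : ℕ) : ∃ n₀ : ℕ, ∀ n ≥ n₀, A * (Nat.log 2 n + 1) ^ B ≤ n := by
  have hT := tendsto_pow_const_div_const_pow_of_one_lt B (one_lt_two : (1 : ℝ) < 2)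
  have hpos : (0 : ℝ) < 1 / (2 * (A : ℝ) + 1) := by positivity
  obtain ⟨m₀, hm₀⟩ := Filter.eventually_atTop.mp (Filter.Tendsto.eventually_lt_const hpos hT)
  refine ⟨2 ^ (m₀ + 1), fun n hn => ?_⟩
  have hn0 : n ≠ 0 := by
    have := Nat.one_le_two_pow (n := m₀ + 1)
    omega
  set m := Nat.log 2 n with hm
  have hm₀m : m₀ + 1 ≤ m := Nat.le_log_of_pow_le one_lt_two hn
  have key := hm₀ (m + 1) (by omega)
  rw [div_lt_div_iff₀ (by positivity) (by positivity), one_mul] at key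
  have key' : (m + 1) ^ B * (2 * A + 1) < 2 ^ (m + 1) := by exact_mod_cast key
  have h2m : 2 ^ m ≤ n := Nat.pow_log_le_self 2 hn0
  have hA : A * (m + 1) ^ B ≤ 2 ^ m := by
    have e : (m + 1) ^ B * (2 * A + 1) = 2 * (A * (m + 1) ^ B) + (m + 1) ^ B := by ring
    rw [e, pow_succ] at key'
    omega
  exact hA.trans h2m

end Growth

variable {p : ℕ} [Fact p.Prime]

/-- **(c0) DECIDED MODULO BOGOLYUBOV–RUZSA (kernel).**  For `p ≥ 5` and a Bogolyubov–Ruzsa constant `C` for `𝔽_p` there is `n₀` such that for all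
`n ≥ n₀` and all `k ≤ (log₂ n)^Cexp`, every register family in the OneQuad normal form (registers `g ≠ g₀` are `k`-forms mod `p` of the input,
`g₀ = H(k label forms, quadVal M b)`) loses some ring word. -/
theorem loss_of_oneQuad (hp5 : 5 ≤ p) (C : ℝ) (hC : 0 ≤ C)
    (hBR : ∀ (n : ℕ) (A : Finset (Fin n → ZMod p)) (α : ℝ), 0 < α → α ≤ 1 → α * (p : ℝ) ^ n ≤ A.card →
      ∃ V : Submodule (ZMod p) (Fin n → ZMod p),
        ((n : ℝ) - finrank (ZMod p) V) ≤ C * (1 + Real.log (1 / α)) ^ 4 ∧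
        ∀ v ∈ V, ∃ a₁ ∈ A, ∃ a₂ ∈ A, ∃ a₃ ∈ A, ∃ a₄ ∈ A, v = a₁ + a₂ - a₃ - a₄)
    (Cexp : ℕ) :
    ∃ n₀ : ℕ, ∀ n ≥ n₀, ∀ k ≤ (Nat.log 2 n) ^ Cexp, ∀ (c : ℕ) (y : Fin (n + 1) → (Fin n → Bool) → Bool) (g₀ : Fin (n + 1))
      (lam : Fin (n + 1) → Fin k → Fin n → ZMod p) (F : Fin (n + 1) → (Fin k → ZMod p) → Bool),
      (∀ g, g ≠ g₀ → ∀ u, y g u = F g (fun j => ∑ i, if u i = true then lam g j i else 0)) →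
      ∀ (Λ : Fin k → Fin n → ZMod p) (M : Fin n → Fin n → ZMod p) (b : Fin n → ZMod p)
        (H : (Fin k → ZMod p) → ZMod p → Bool),
        (∀ u, y g₀ u = H (fun j => ∑ i, if u i = true then Λ j i else 0) (quadVal M b u)) →
        ∃ u, ringWinU c y u = false := by
  classical
  obtain ⟨ppi, eppi⟩ : ∃ ppi : ℕ, ppi = Nat.log 2 p + 1 := ⟨_, rfl⟩
  obtain ⟨C₁, eC₁⟩ : ∃ C₁ : ℕ, C₁ = ⌈C⌉₊ := ⟨_, rfl⟩
  obtain ⟨n₀, hn₀⟩ := polylog_eventually_le ((2 * p * (C₁ + 1)) ^ 78) ((Cexp + 1) * 78)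
  refine ⟨n₀, fun n hn k hk c y g₀ lam F hF Λ M b H hy₀ => ?_⟩
  have hP : p.Prime := Fact.out
  have hp3 : p.Coprime 3 := (Nat.coprime_primes hP Nat.prime_three).mpr (by omega)
  have hp2 : 2 ≤ p := by omega
  obtain ⟨ℓ, eℓ⟩ : ∃ ℓ : ℕ, ℓ = Nat.log 2 n + 1 := ⟨_, rfl⟩
  -- the parameters (opaque names with defining equations)
  obtain ⟨r, er⟩ : ∃ r : ℕ, r = 3 * ppi * k + ℓ + 4 := ⟨_, rfl⟩
  obtain ⟨w, ew⟩ : ∃ w : ℕ, w = 4 * p ^ 2 * (3 + (r + k + 1) * p) + r := ⟨_, rfl⟩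
  obtain ⟨w₂, ew₂⟩ : ∃ w₂ : ℕ, w₂ = 4 * p ^ 2 * (6 + 2 * (r + k + 1) * p) := ⟨_, rfl⟩
  obtain ⟨L, eL⟩ : ∃ L : ℕ, L = 5 + 2 * (r + k + 1) + (ℓ + 1) * w₂ := ⟨_, rfl⟩
  obtain ⟨h, eh⟩ : ∃ h : ℕ, h = 2 * p ^ 2 * (L * p) := ⟨_, rfl⟩
  obtain ⟨Fl, eFl⟩ : ∃ Fl : ℕ, Fl = C₁ * (1 + L * p) ^ 4 := ⟨_, rfl⟩
  obtain ⟨r₀, er₀⟩ : ∃ r₀ : ℕ, r₀ = 8 * h + Fl + 5 + ppi * (2 * (r + k + 1)) := ⟨_, rfl⟩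
  obtain ⟨t, et⟩ : ∃ t : ℕ, t = ℓ + ppi * (k + (6 * r₀ + 1)) + 2 := ⟨_, rfl⟩
  obtain ⟨t', et'⟩ : ∃ t' : ℕ, t' = ℓ + ppi * (k + (2 * (r + k) + 1)) + 2 := ⟨_, rfl⟩
  obtain ⟨f, ef⟩ : ∃ f : ℕ, f = (2 * p - 1) * t' := ⟨_, rfl⟩
  obtain ⟨N, eN⟩ : ∃ N : ℕ, N = w * (f * f) + 2 := ⟨_, rfl⟩
  -- base facts
  have hpπ : p < 2 ^ ppi := by rw [eppi]; exact Nat.lt_pow_succ_log_self one_lt_two p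
  have hnℓ : n < 2 ^ ℓ := by rw [eℓ]; exact Nat.lt_pow_succ_log_self one_lt_two n
  have hppow : ∀ a, p ^ a ≤ 2 ^ (ppi * a) := fun a => by rw [pow_mul]; exact Nat.pow_le_pow_left hpπ.le a
  have h2p : ∀ a, 2 ^ a ≤ p ^ a := fun a => Nat.pow_le_pow_left hp2 a
  -- (hcountB)
  have hcountB : 3 * p ^ k * p ^ k * ((n + 1) * (p ^ k * 2) + 1) < 2 ^ r := by
    have h1 : 3 * p ^ k * p ^ k < 2 ^ (2 + ppi * k + ppi * k) := by
      rw [pow_add, pow_add]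
      have := hppow k
      calc 3 * p ^ k * p ^ k ≤ 3 * 2 ^ (ppi * k) * 2 ^ (ppi * k) :=
            Nat.mul_le_mul (Nat.mul_le_mul_left _ this) this
        _ < 2 ^ 2 * 2 ^ (ppi * k) * 2 ^ (ppi * k) := by
            have : 0 < 2 ^ (ppi * k) * 2 ^ (ppi * k) := by positivity
            nlinarith
    have h2 : (n + 1) * (p ^ k * 2) + 1 ≤ 2 ^ (ℓ + ppi * k + 2) := by
      have h21 : (n + 1) * (p ^ k * 2) ≤ 2 ^ (ℓ + ppi * k + 1) := by
        rw [pow_add, pow_add, pow_one, mul_assoc]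
        exact Nat.mul_le_mul (by omega) (Nat.mul_le_mul_right _ (hppow k))
      have h22 : 1 ≤ 2 ^ (ℓ + ppi * k + 1) := Nat.one_le_two_pow
      calc (n + 1) * (p ^ k * 2) + 1 ≤ 2 ^ (ℓ + ppi * k + 1) + 2 ^ (ℓ + ppi * k + 1) := by omega
        _ = 2 ^ (ℓ + ppi * k + 2) := by rw [pow_succ]; ring
    calc 3 * p ^ k * p ^ k * ((n + 1) * (p ^ k * 2) + 1) ≤ 3 * p ^ k * p ^ k * 2 ^ (ℓ + ppi * k + 2) :=
          Nat.mul_le_mul_left _ h2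
      _ < 2 ^ (2 + ppi * k + ppi * k) * 2 ^ (ℓ + ppi * k + 2) := Nat.mul_lt_mul_of_pos_right h1 (by positivity)
      _ = 2 ^ r := by rw [← pow_add, er]; ring_nf
  -- (hL)
  have hLcond : 1296 * p ^ (2 * (r + k + 1)) * (n * p + 1) ^ w₂ ≤ p ^ L := by
    have h1 : 1296 ≤ p ^ 5 := le_trans (by norm_num) (Nat.pow_le_pow_left hp5 5)
    have h2 : n * p + 1 ≤ p ^ (ℓ + 1) := by
      have : n + 1 ≤ p ^ ℓ := le_trans (by omega) (h2p ℓ)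
      rw [pow_succ]
      calc n * p + 1 ≤ n * p + p := by omega
        _ = (n + 1) * p := by ring
        _ ≤ p ^ ℓ * p := Nat.mul_le_mul_right _ this
    have h3 : (n * p + 1) ^ w₂ ≤ p ^ ((ℓ + 1) * w₂) := by rw [pow_mul]; exact Nat.pow_le_pow_left h2 _
    calc 1296 * p ^ (2 * (r + k + 1)) * (n * p + 1) ^ w₂ ≤ p ^ 5 * p ^ (2 * (r + k + 1)) * p ^ ((ℓ + 1) * w₂) :=
          Nat.mul_le_mul (Nat.mul_le_mul_right _ h1) h3
      _ = p ^ L := by rw [eL, pow_add, pow_add]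
  -- (hr₀a)
  have hr₀a : 648 * p ^ (2 * (r + k + 1)) ≤ 4 ^ r₀ := by
    have h1 : (648 : ℕ) ≤ 4 ^ 5 := by norm_num
    have h2 : p ^ (2 * (r + k + 1)) ≤ 4 ^ (ppi * (2 * (r + k + 1))) :=
      (hppow _).trans (Nat.pow_le_pow_left (by norm_num) _)
    calc 648 * p ^ (2 * (r + k + 1)) ≤ 4 ^ 5 * 4 ^ (ppi * (2 * (r + k + 1))) := Nat.mul_le_mul h1 h2
      _ = 4 ^ (5 + ppi * (2 * (r + k + 1))) := by rw [pow_add]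
      _ ≤ 4 ^ r₀ := Nat.pow_le_pow_right (by norm_num) (by rw [er₀]; omega)
  -- (hr₀): the floor of the Sanders codimension is below `Fl`
  have hFlb : ⌊C * (1 + L * Real.log p) ^ 4⌋₊ ≤ Fl := by
    apply Nat.floor_le_of_le
    have hp0 : (0 : ℝ) < p := by exact_mod_cast (show 0 < p by omega)
    have hlog0 : 0 ≤ Real.log p := Real.log_nonneg (by exact_mod_cast (show 1 ≤ p by omega))
    have hlogp : Real.log p ≤ p := (Real.log_le_sub_one_of_pos hp0).trans (by linarith)
    have h1 : (1 + L * Real.log p) ^ 4 ≤ (1 + (L : ℝ) * p) ^ 4 :=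
      pow_le_pow_left₀ (by positivity) (by nlinarith [(Nat.cast_nonneg L : (0 : ℝ) ≤ L)]) 4
    have hCC₁ : C ≤ (C₁ : ℝ) := by rw [eC₁]; exact Nat.le_ceil C
    have h2 : C * (1 + L * Real.log p) ^ 4 ≤ (C₁ : ℝ) * (1 + (L : ℝ) * p) ^ 4 :=
      mul_le_mul hCC₁ h1 (by positivity) (by positivity)
    calc C * (1 + L * Real.log p) ^ 4 ≤ (C₁ : ℝ) * (1 + (L : ℝ) * p) ^ 4 := h2
      _ = (Fl : ℝ) := by rw [eFl]; push_cast; ring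
  have hr₀c : 8 * h + ⌊C * (1 + L * Real.log p) ^ 4⌋₊ ≤ r₀ := by rw [er₀]; omega
  -- (ht), (ht')
  have hpow2 : ∀ a e : ℕ, e = ℓ + ppi * a + 2 → (n + 1) * (p ^ a * 2) < 2 ^ e := by
    intro a e he
    have h1 : (n + 1) * (p ^ a * 2) ≤ 2 ^ (ℓ + ppi * a + 1) := by
      rw [pow_add, pow_add, pow_one, mul_assoc]
      exact Nat.mul_le_mul (by omega) (Nat.mul_le_mul_right _ (hppow a))
    rw [he]
    exact lt_of_le_of_lt h1 (Nat.pow_lt_pow_right (by norm_num) (by omega))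
  have htc : (n + 1) * (p ^ (k + (6 * r₀ + 1)) * 2) < 2 ^ t := hpow2 _ _ et
  have ht'c : (n + 1) * (p ^ (k + (2 * (r + k) + 1)) * 2) < 2 ^ t' := hpow2 _ _ et'
  -- (hn): everything is polylogarithmic.  `X := 2p(C₁+1)·ℓ^(Cexp+1)` dominates every atom.
  obtain ⟨X, eX⟩ : ∃ X : ℕ, X = 2 * p * (C₁ + 1) * ℓ ^ (Cexp + 1) := ⟨_, rfl⟩
  have hℓ1 : 1 ≤ ℓ := by omega
  have hℓpow : 1 ≤ ℓ ^ (Cexp + 1) := Nat.one_le_pow _ _ hℓ1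
  have h2pX : 2 * p * (C₁ + 1) ≤ X := by
    have := Nat.mul_le_mul_left (2 * p * (C₁ + 1)) hℓpow
    rw [mul_one] at this
    rw [eX]; exact this
  have h2pX' : 2 * p ≤ X := le_trans (Nat.le_mul_of_pos_right _ (by omega)) h2pX
  have hC₁X : C₁ ≤ X := le_trans ((Nat.le_succ C₁).trans (Nat.le_mul_of_pos_left (C₁ + 1) (by omega))) h2pX
  have hX10 : 10 ≤ X := by omega
  have hX1 : 1 ≤ X := by omega
  have hX2 : 2 ≤ X := by omega
  have hX3 : 3 ≤ X := by omega
  -- local power bookkeeping (folklore; cf. `DepthFregeHalving.xb_mul/xb_add`)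
  have pw_mul : ∀ {a b i j : ℕ}, a ≤ X ^ i → b ≤ X ^ j → a * b ≤ X ^ (i + j) :=
    fun ha hb => by rw [pow_add]; exact Nat.mul_le_mul ha hb
  have pw_add : ∀ {a b i : ℕ}, a ≤ X ^ i → b ≤ X ^ i → a + b ≤ X ^ (i + 1) :=
    fun {a b i} ha hb => by
      rw [pow_succ]
      calc a + b ≤ X ^ i * 2 := by omega
        _ ≤ X ^ i * X := Nat.mul_le_mul_left _ hX2
  have pw_add3 : ∀ {a b d i : ℕ}, a ≤ X ^ i → b ≤ X ^ i → d ≤ X ^ i → a + b + d ≤ X ^ (i + 1) :=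
    fun {a b d i} ha hb hd => by
      rw [pow_succ]
      calc a + b + d ≤ X ^ i * 3 := by omega
        _ ≤ X ^ i * X := Nat.mul_le_mul_left _ hX3
  have pw_up : ∀ {a i : ℕ}, a ≤ X ^ i → ∀ j : ℕ, i ≤ j → a ≤ X ^ j :=
    fun h j hij => h.trans (Nat.pow_le_pow_right hX1 hij)
  have pw_pow : ∀ {a i : ℕ}, a ≤ X ^ i → ∀ m : ℕ, a ^ m ≤ X ^ (i * m) :=
    fun h m => by rw [pow_mul]; exact Nat.pow_le_pow_left h m
  have hℓX : ℓ ≤ X := by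
    have h1 : ℓ ≤ ℓ ^ (Cexp + 1) := Nat.le_self_pow (by omega) ℓ
    have h2 : ℓ ^ (Cexp + 1) ≤ X := by
      have := Nat.mul_le_mul_right (ℓ ^ (Cexp + 1)) (show 1 ≤ 2 * p * (C₁ + 1) from Nat.mul_pos (by omega) (by omega))
      rw [one_mul] at this
      rw [eX]; exact this
    exact h1.trans h2
  have hkX : k ≤ X := by
    have h1 : (Nat.log 2 n) ^ Cexp ≤ ℓ ^ Cexp := Nat.pow_le_pow_left (by omega) _
    have h2 : ℓ ^ Cexp ≤ ℓ ^ (Cexp + 1) := Nat.pow_le_pow_right hℓ1 (by omega)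
    have h3 : ℓ ^ (Cexp + 1) ≤ X := by
      have := Nat.mul_le_mul_right (ℓ ^ (Cexp + 1)) (show 1 ≤ 2 * p * (C₁ + 1) from Nat.mul_pos (by omega) (by omega))
      rw [one_mul] at this
      rw [eX]; exact this
    exact hk.trans (h1.trans (h2.trans h3))
  have hπX : ppi ≤ X := by
    have : Nat.log 2 p < p := Nat.log_lt_self 2 (by omega)
    omega
  have hC₁1le : 1 ≤ 2 * p * (C₁ + 1) := Nat.mul_pos (by omega) (by omega)
  -- atoms as first powers
  have A1 : ∀ a, a ≤ X → a ≤ X ^ 1 := fun a ha => by rw [pow_one]; exact ha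
  have hp1 := A1 p (by omega)
  have hk1 := A1 k hkX
  have hℓ1' := A1 ℓ hℓX
  have hπ1 := A1 ppi hπX
  have hC₁1 := A1 C₁ hC₁X
  have h1_1 := A1 1 (by omega)
  have h2_1 := A1 2 (by omega)
  have h3_1 := A1 3 (by omega)
  have h4_1 := A1 4 (by omega)
  have h5_1 := A1 5 (by omega)
  have h6_1 := A1 6 (by omega)
  have h8_1 := A1 8 (by omega)
  have h2p1 := A1 (2 * p - 1) (by omega)
  have hp11 := A1 (p - 1) (by omega)
  have hp2X : p ^ 2 ≤ X ^ 2 := Nat.pow_le_pow_left (by omega) 2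
  -- r ≤ X^4
  have hrX : r ≤ X ^ 4 := by
    rw [er]; exact pw_add3 (pw_mul (pw_mul h3_1 hπ1) hk1) (pw_up hℓ1' 3 (by norm_num)) (pw_up h4_1 3 (by norm_num))
  have hrk1 : r + k + 1 ≤ X ^ 5 := pw_add3 hrX (pw_up hk1 4 (by norm_num)) (pw_up h1_1 4 (by norm_num))
  have h4p2 : 4 * p ^ 2 ≤ X ^ 3 := pw_mul h4_1 hp2X
  -- w, w₂ ≤ X^11
  have hwX : w ≤ X ^ 11 := by
    rw [ew]; exact pw_add (pw_mul h4p2 (pw_add (pw_up h3_1 6 (by norm_num)) (pw_mul hrk1 hp1)))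
      (pw_up hrX 10 (by norm_num))
  have h2rk : 2 * (r + k + 1) ≤ X ^ 6 := pw_mul h2_1 hrk1
  have hw₂X : w₂ ≤ X ^ 11 := by
    rw [ew₂]; exact pw_mul h4p2 (pw_add (pw_up h6_1 7 (by norm_num)) (pw_mul h2rk hp1))
  -- L ≤ X^14, h ≤ X^18, Fl ≤ X^65, r₀ ≤ X^68
  have hLX : L ≤ X ^ 14 := by
    rw [eL]; exact pw_add3 (pw_up h5_1 13 (by norm_num)) (pw_up h2rk 13 (by norm_num))
      (pw_mul (pw_add hℓ1' h1_1) hw₂X)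
  have hLp : L * p ≤ X ^ 15 := pw_mul hLX hp1
  have hhX : h ≤ X ^ 18 := by rw [eh]; exact pw_mul (pw_mul h2_1 hp2X) hLp
  have hFlX : Fl ≤ X ^ 65 := by
    rw [eFl]; exact pw_mul hC₁1 (pw_pow (pw_add (pw_up h1_1 15 (by norm_num)) hLp) 4)
  have hr₀X : r₀ ≤ X ^ 68 := by
    rw [er₀]; exact pw_add
      (pw_add (pw_add (pw_up (pw_mul h8_1 hhX) 65 (by norm_num)) hFlX) (pw_up h5_1 66 (by norm_num)))
      (pw_up (pw_mul hπ1 h2rk) 67 (by norm_num))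
  -- t ≤ X^74, t' ≤ X^11, f ≤ X^12, N ≤ X^36
  have htX : t ≤ X ^ 74 := by
    rw [et]; exact pw_add
      (pw_add (pw_up hℓ1' 72 (by norm_num))
        (pw_mul hπ1 (pw_add (pw_up hk1 70 (by norm_num))
          (pw_add (pw_mul h6_1 hr₀X) (pw_up h1_1 69 (by norm_num))))))
      (pw_up h2_1 73 (by norm_num))
  have ht'X : t' ≤ X ^ 11 := by
    rw [et']; exact pw_add
      (pw_add (pw_up hℓ1' 9 (by norm_num))
        (pw_mul hπ1 (pw_add (pw_up hk1 7 (by norm_num))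
          (pw_add (pw_mul h2_1 (pw_add hrX (pw_up hk1 4 (by norm_num))))
            (pw_up h1_1 6 (by norm_num))))))
      (pw_up h2_1 10 (by norm_num))
  have hfX : f ≤ X ^ 12 := by rw [ef]; exact pw_mul h2p1 ht'X
  have hNX : N ≤ X ^ 36 := by rw [eN]; exact pw_add (pw_mul hwX (pw_mul hfX hfX)) (pw_up h2_1 35 (by norm_num))
  -- the left-hand side of `hn`
  have s2 : k * w + w + r ≤ X ^ 14 :=
    pw_add (pw_add (pw_mul hk1 hwX) (pw_up hwX 12 (by norm_num))) (pw_up hrX 13 (by norm_num))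
  have s3 : k * w + w + r + (2 * p - 1) * t ≤ X ^ 76 :=
    pw_add (pw_up s2 75 (by norm_num)) (pw_mul h2p1 htX)
  have s4 : k * w + w + r + (2 * p - 1) * t + (p - 1) * N ≤ X ^ 77 :=
    pw_add s3 (pw_up (pw_mul hp11 hNX) 76 (by norm_num))
  have hLHS : k * w + w + r + (2 * p - 1) * t + (p - 1) * N + 1 ≤ X ^ 78 :=
    pw_add s4 (pw_up h1_1 77 (by norm_num))
  have hXB : X ^ 78 = (2 * p * (C₁ + 1)) ^ 78 * ℓ ^ ((Cexp + 1) * 78) := by rw [eX, mul_pow, ← pow_mul]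
  have hn₀' : (2 * p * (C₁ + 1)) ^ 78 * ℓ ^ ((Cexp + 1) * 78) ≤ n := by rw [eℓ]; exact hn₀ n hn
  have hnc : k * w + w + r + (2 * p - 1) * t + (p - 1) * N + 1 ≤ n :=
    hLHS.trans (hXB.le.trans hn₀')
  have hhc : 2 * p ^ 2 * (L * p) ≤ h + 1 := by rw [eh]; exact Nat.le_succ _
  exact loss_of_oneQuad_param hp5 hp3 c y g₀ lam F hF Λ M b H hy₀ C hC hBR w w₂ r h L r₀ t N f t' ew.ge ew₂.ge hnc hr₀a hLcond
    hr₀c hhc htc hcountB eN.ge ef.ge ht'c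

/-- [verbatim NODE-g27 §18 / g28 `CoSupportDial.OneQuad`] the (c0) normal form: `k`-form registers except ONE register reading a quadratic form
through its labels -/
def OneQuad (p : ℕ) [Fact p.Prime] {n : ℕ} (k : ℕ) (y : Fin (n + 1) → (Fin n → Bool) → Bool) : Prop :=
  ∃ (g₀ : Fin (n + 1)) (lam : Fin (n + 1) → Fin k → Fin n → ZMod p) (F : Fin (n + 1) → (Fin k → ZMod p) → Bool)
    (M : Fin n → Fin n → ZMod p) (b : Fin n → ZMod p) (G : (Fin k → ZMod p) → ZMod p → Bool),
    (∀ g, g ≠ g₀ → ∀ u, y g u = F g (fun j => ∑ i, if u i = true then lam g j i else 0)) ∧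
    ∀ u, y g₀ u = G (fun j => ∑ i, if u i = true then lam g₀ j i else 0) (InnerDegreeDial.quadVal M b u)

/-- [verbatim NODE-g27 §18 / g28 `CoSupportDial.OneQuadNoPerfectOdd`] the (c0) sub-rung: no perfect OneQuad strategy of polylog width
(the degree hypothesis is carried verbatim and not used) -/
def OneQuadNoPerfectOdd : Prop :=
  ∀ (p : ℕ) [Fact p.Prime], 5 ≤ p → ∀ C : ℕ, ∃ n₀ : ℕ, ∀ n ≥ n₀, ∀ c : ℕ,
    ∀ y : Fin (n + 1) → (Fin n → Bool) → Bool,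
      (∀ g, HasDegF p (y g) ((Nat.log 2 n) ^ C)) → OneQuad p ((Nat.log 2 n) ^ C) y → ∃ u, ringWinU c y u = false

/-- **★ (c0) FOLLOWS FROM BOGOLYUBOV–RUZSA WITH SANDERS' BOUND (kernel).**  The hypothesis is, verbatim, the body of the typed Literature fact
`Literature.Combinatorics.Additive.bogolyubovRuzsaFiniteField` (Sanders 2012, Thm 20 / 1.1 in the finite-field model). -/
theorem oneQuadNoPerfectOdd_of_BR
    (hBR : ∀ (p : ℕ) [Fact p.Prime], ∃ C : ℝ, 0 < C ∧
      ∀ (n : ℕ) (A : Finset (Fin n → ZMod p)) (α : ℝ), 0 < α → α ≤ 1 → α * (p : ℝ) ^ n ≤ A.card →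
        ∃ V : Submodule (ZMod p) (Fin n → ZMod p),
          ((n : ℝ) - Module.finrank (ZMod p) V) ≤ C * (1 + Real.log (1 / α)) ^ 4 ∧
          ∀ v ∈ V, ∃ a₁ ∈ A, ∃ a₂ ∈ A, ∃ a₃ ∈ A, ∃ a₄ ∈ A, v = a₁ + a₂ - a₃ - a₄) :
    OneQuadNoPerfectOdd := by
  intro p _ hp5 Cexp
  obtain ⟨C, hCpos, hBRp⟩ := hBR p
  obtain ⟨n₀, hn₀⟩ := loss_of_oneQuad hp5 C hCpos.le hBRp Cexp
  refine ⟨n₀, fun n hn c y _ hq => ?_⟩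
  obtain ⟨g₀, lam, F, M, b, G, hF, hy₀⟩ := hq
  exact hn₀ n hn _ le_rfl c y g₀ lam F hF (lam g₀) M b G hy₀

end Summit.QuantumAdvantage.QuantumAdvantage.Theorems.ColumnBridge
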